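import Summits.ValiantsHypothesis.ValiantsHypothesis.Theorems.ProjectionStabilityUniqStepStubCellsOther

/-! # Crux `UniqStep` (stmt-ValiantsHypothesis-17834), line `Sketch` (phase 2: the purified source twist) — stub `stub_cells_special`:
# the three special rows `∅`, `{0}`, `{1}` of the purified matrix are honest, and `X (0,0)` sits in exactly three of their cells

WHAT. Notation as in `…StubCellsOther.lean` (`n = k + 3`, rows/columns indexed by `Finset (Fin n)`,
`adj := Grenet.adj ℂ n`, `K_full := P · (1 − adj) · EQ` with `P`, `EQ` entering through their row and
column actions). This file proves (`stub_cells_special`): in the rows `∅`, `{0}`, `{1}` and every column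
`T ≠ ∅` the cell `K_full S T` is `−X v` or a constant, and the coefficient of `X (0, 0)` in it is `−1`
exactly at `(∅, {0})`, `({1}, {0})`, `(∅, {1, 2})` and `0` elsewhere. The computation (row action then
column action, cells of `1 − adj` from `Literature/…/GrenetAdjCells.lean`):
* row `∅` of `P (1 − adj)` is `−(1 − adj) ∅ + (1 − adj) {0,1}`; in the column `{1,2}` the column action
  produces `0 − X(1,0)·X(0,0) + X(0,0)·X(1,0) − X(0,0) = −X(0,0)` (the Koszul cancellation that makes the
  twist possible), in `{1}`: `−X(1,0)`, in `{j}`: `−X(j,0)`, elsewhere the row `{0,1}` of `1 − adj`;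
* row `{0}` of `P (1 − adj)` is `(1 − adj) {0} + (1 − adj) {1,2}`: column `{1,2}`: `1 − X(1,0) − 1 =
  −X(1,0)`, `{1}`: `−adj {0} {0,2} = −X(2,1)`, `{0}`: `−1`, other singletons `0`, elsewhere `−adj {0} T`
  (`|T| = 2`) or `−adj {1,2} T` (`|T| ≥ 3`);
* row `{1}` of `P (1 − adj)` is `−(1 − adj) ∅ + (1 − adj) {1} + (1 − adj) {0,2}`: column `{1,2}`:
  `−X(2,1) − X(1,0)X(0,0) + X(0,0)(X(1,0) + 1) − X(0,0) = −X(2,1)`, `{1}`: `−(X(1,0)+1) + 1 = −X(1,0)`,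
  `{j}`: `−X(j,0)`, `{0,2}`: `1`, elsewhere `−adj {1} T` (`|T| = 2`) or `−adj {0,2} T` (`|T| ≥ 3`).

WHY. Stub V3a of the line; with V3b it gives the honesty of the signed `(univ, ∅)`-minor of `K_full`
and the support of its `X (0,0)`-coefficient matrix (rank `2`), whence the second, inequivalent optimal
projection of `per_n` and the vacuity of the crux's antecedent `Uniq n`.

SOURCE. This session's construction (exact computations `compute/purify_*.py`, `n = 3, …, 7`); Grenet
2011 Thm. 1 for the matrix; the `(3, 7)` instance of the twist is Hüttenhain–Ikenmeyer 2016 §4 folklore.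
-/

-- D-0017 layout: Sub = Summit for this single-conjunct summit, so the namespace repeats a component.
set_option linter.dupNamespace false

namespace Summit.ValiantsHypothesis.ValiantsHypothesis.Theorems.ProjectionStabilityUniqStep

open MvPolynomial
open scoped BigOperators Matrix
open Literature.Computability.AlgebraicComplexity

noncomputable section

/-! ### Leaf shapes with the `X (0,0)`-coefficient bookkeeping -/

/-- A constant cell, when the `X (0,0)`-flag is off. [folklore] -/
theorem special_leaf_C {k : ℕ} {x : MvPolynomial (Fin (k + 3) × Fin (k + 3)) ℂ} {q : Prop} [Decidable q]
    (c : ℂ) (hx : x = C c) (hq : ¬ q) :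
    ((∃ v, x = -X v) ∨ ∃ c, x = C c) ∧
      MvPolynomial.coeff (Finsupp.single ((0 : Fin (k + 3)), (0 : Fin (k + 3))) 1) x =
        if q then -1 else 0 := by
  rw [if_neg hq]; exact isPure_and_coeff_zero_of_eq_C c hx

/-- A cell `−adj S' T'` with `S' ≠ ∅`, when the `X (0,0)`-flag is off. [folklore] -/
theorem special_leaf_neg_adj {k : ℕ} {x : MvPolynomial (Fin (k + 3) × Fin (k + 3)) ℂ} {q : Prop} [Decidable q]
    {S' : Finset (Fin (k + 3))} (T' : Finset (Fin (k + 3))) (hS' : S' ≠ ∅)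
    (hx : x = -Grenet.adj ℂ (k + 3) S' T') (hq : ¬ q) :
    ((∃ v, x = -X v) ∨ ∃ c, x = C c) ∧
      MvPolynomial.coeff (Finsupp.single ((0 : Fin (k + 3)), (0 : Fin (k + 3))) 1) x =
        if q then -1 else 0 := by
  rw [if_neg hq]; exact isPure_and_coeff_zero_of_eq_neg_adj T' hS' hx

/-- A level-`0` variable cell `−X (j, 0)`: its `X (0,0)`-coefficient is `−[j = 0]`. [folklore] -/
theorem special_leaf_neg_X {k : ℕ} {x : MvPolynomial (Fin (k + 3) × Fin (k + 3)) ℂ} {q : Prop} [Decidable q]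
    (j : Fin (k + 3)) (hx : x = -X (j, 0)) (hq : q ↔ j = 0) :
    ((∃ v, x = -X v) ∨ ∃ c, x = C c) ∧
      MvPolynomial.coeff (Finsupp.single ((0 : Fin (k + 3)), (0 : Fin (k + 3))) 1) x =
        if q then -1 else 0 := by
  subst hx
  refine ⟨Or.inl ⟨(j, 0), rfl⟩, ?_⟩
  by_cases hj : j = 0
  · subst hj
    rw [if_pos (hq.2 rfl), coeff_neg, coeff_X_same]
  · rw [if_neg (fun h => hj (hq.1 h)), coeff_neg, coeff_X, if_neg, neg_zero]
    intro h
    exact hj (Prod.ext_iff.1 ((Finsupp.single_left_inj one_ne_zero).1 h)).1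

/-! ### The stub -/

/-- **STUB V3a** of line `Sketch` (phase 2) of crux `UniqStep`: in the rows `∅`, `{0}`, `{1}` and every
column `T ≠ ∅` of the purified matrix `P · (1 − adj) · EQ` (with `P`, `EQ` given by their row and column
actions) the cell is `−X v` or a constant, and its `X (0,0)`-coefficient is `−1` exactly at
`(∅,{0})`, `({1},{0})`, `(∅,{1,2})`. [folklore] -/
theorem stub_cells_special :
    ∀ (k : ℕ) (P EQ : Matrix (Finset (Fin (k + 3))) (Finset (Fin (k + 3))) (MvPolynomial (Fin (k + 3) × Fin (k + 3)) ℂ)),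
    (∀ (M : Matrix (Finset (Fin (k + 3))) (Finset (Fin (k + 3))) (MvPolynomial (Fin (k + 3) × Fin (k + 3)) ℂ))
        (S T : Finset (Fin (k + 3))),
      (P * M) S T =
        if S = ∅ then -M ∅ T + M {0, 1} T
        else if S = {0} then M {0} T + M {1, 2} T
        else if S = {1} then -M ∅ T + M {1} T + M {0, 2} T
        else if S.card = 1 then M S T + M {0, 1} T
        else M S T) →
    (∀ (M : Matrix (Finset (Fin (k + 3))) (Finset (Fin (k + 3))) (MvPolynomial (Fin (k + 3) × Fin (k + 3)) ℂ))
        (S T : Finset (Fin (k + 3))),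
      (M * EQ) S T =
        if T = {1, 2} then M S {1, 2} - X (1, 0) * M S {0} + X (0, 0) * M S {1} - M S {0}
        else if T = {1} then -M S {1} + M S {0, 2}
        else if T.card = 1 then -M S T
        else M S T) →
    ∀ S T : Finset (Fin (k + 3)), (S = ∅ ∨ S = {0} ∨ S = {1}) → T ≠ ∅ →
      ((∃ v, (P * (1 - Grenet.adj ℂ (k + 3)) * EQ) S T = -X v) ∨
        ∃ c, (P * (1 - Grenet.adj ℂ (k + 3)) * EQ) S T = C c) ∧
      MvPolynomial.coeff (Finsupp.single ((0 : Fin (k + 3)), (0 : Fin (k + 3))) 1)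
          ((P * (1 - Grenet.adj ℂ (k + 3)) * EQ) S T) =
        if (S = ∅ ∧ T = {0}) ∨ (S = {1} ∧ T = {0}) ∨ (S = ∅ ∧ T = {1, 2}) then -1 else 0 := by
  intro k P EQ hP hEQ S T hS hT
  set A := Grenet.adj ℂ (k + 3) with hA
  -- distinctness of `0, 1, 2` and the small Finset facts
  have h01 : (0 : Fin (k + 3)) ≠ 1 := Fin.ne_of_val_ne (show (0 : ℕ) ≠ 1 by decide)
  have h02 : (0 : Fin (k + 3)) ≠ 2 := Fin.ne_of_val_ne (show (0 : ℕ) ≠ 2 by decide)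
  have h12 : (1 : Fin (k + 3)) ≠ 2 := Fin.ne_of_val_ne (show (1 : ℕ) ≠ 2 by decide)
  have c01 : ({0, 1} : Finset (Fin (k + 3))).card = 2 := Finset.card_pair h01
  have c02 : ({0, 2} : Finset (Fin (k + 3))).card = 2 := Finset.card_pair h02
  have c12 : ({1, 2} : Finset (Fin (k + 3))).card = 2 := Finset.card_pair h12
  have ne0 : ({0} : Finset (Fin (k + 3))) ≠ ∅ := Finset.singleton_ne_empty 0
  have ne1 : ({1} : Finset (Fin (k + 3))) ≠ ∅ := Finset.singleton_ne_empty 1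
  have n01e : ({0, 1} : Finset (Fin (k + 3))) ≠ ∅ := Finset.insert_ne_empty 0 {1}
  have n02e : ({0, 2} : Finset (Fin (k + 3))) ≠ ∅ := Finset.insert_ne_empty 0 {2}
  have n12e : ({1, 2} : Finset (Fin (k + 3))) ≠ ∅ := Finset.insert_ne_empty 1 {2}
  have n_0_1 : ({0} : Finset (Fin (k + 3))) ≠ {1} := fun h => h01 (Finset.singleton_inj.1 h)
  have n_1_12 : ({1} : Finset (Fin (k + 3))) ≠ {1, 2} :=
    ne_of_apply_ne Finset.card (by rw [Finset.card_singleton, c12]; decide)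
  have n_0_12 : ({0} : Finset (Fin (k + 3))) ≠ {1, 2} :=
    ne_of_apply_ne Finset.card (by rw [Finset.card_singleton, c12]; decide)
  have n_e_12 : (∅ : Finset (Fin (k + 3))) ≠ {1, 2} := Ne.symm n12e
  have n_02_12 : ({0, 2} : Finset (Fin (k + 3))) ≠ {1, 2} :=
    ne_of_mem_of_not_mem' (a := 0) (by simp) (by simp [h01, h02])
  have n_01_12 : ({0, 1} : Finset (Fin (k + 3))) ≠ {1, 2} :=
    ne_of_mem_of_not_mem' (a := 0) (by simp) (by simp [h01, h02])
  have n_01_02 : ({0, 1} : Finset (Fin (k + 3))) ≠ {0, 2} :=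
    ne_of_mem_of_not_mem' (a := 1) (by simp) (by simp [h01.symm, h12])
  have n_1_02 : ({1} : Finset (Fin (k + 3))) ≠ {0, 2} :=
    ne_of_apply_ne Finset.card (by rw [Finset.card_singleton, c02]; decide)
  -- the column action of `EQ`, by cases on the column
  have hE12 : ∀ (M : Matrix (Finset (Fin (k + 3))) (Finset (Fin (k + 3)))
      (MvPolynomial (Fin (k + 3) × Fin (k + 3)) ℂ)) (S' : Finset (Fin (k + 3))),
      (M * EQ) S' {1, 2} = M S' {1, 2} - X (1, 0) * M S' {0} + X (0, 0) * M S' {1} - M S' {0} :=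
    fun M S' => by rw [hEQ, if_pos rfl]
  have hE1 : ∀ (M : Matrix (Finset (Fin (k + 3))) (Finset (Fin (k + 3)))
      (MvPolynomial (Fin (k + 3) × Fin (k + 3)) ℂ)) (S' : Finset (Fin (k + 3))),
      (M * EQ) S' {1} = -M S' {1} + M S' {0, 2} :=
    fun M S' => by rw [hEQ, if_neg n_1_12, if_pos rfl]
  have hEs : ∀ (M : Matrix (Finset (Fin (k + 3))) (Finset (Fin (k + 3)))
      (MvPolynomial (Fin (k + 3) × Fin (k + 3)) ℂ)) (S' T' : Finset (Fin (k + 3))),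
      T' ≠ {1, 2} → T' ≠ {1} → T'.card = 1 → (M * EQ) S' T' = -M S' T' :=
    fun M S' T' h1 h2 h3 => by rw [hEQ, if_neg h1, if_neg h2, if_pos h3]
  have hEg : ∀ (M : Matrix (Finset (Fin (k + 3))) (Finset (Fin (k + 3)))
      (MvPolynomial (Fin (k + 3) × Fin (k + 3)) ℂ)) (S' T' : Finset (Fin (k + 3))),
      T' ≠ {1, 2} → T' ≠ {1} → T'.card ≠ 1 → (M * EQ) S' T' = M S' T' :=
    fun M S' T' h1 h2 h3 => by rw [hEQ, if_neg h1, if_neg h2, if_neg h3]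
  -- cells of `1 − adj` used repeatedly
  have F_e_j : ∀ j : Fin (k + 3), (1 - A) ∅ {j} = -X (j, 0) := fun j => by
    rw [one_sub_adj_apply_of_ne (Ne.symm (Finset.singleton_ne_empty j)), Grenet.adj_empty_singleton]
  have F_e_g : ∀ T' : Finset (Fin (k + 3)), T' ≠ ∅ → T'.card ≠ 1 → (1 - A) ∅ T' = 0 := fun T' hne h =>
    one_sub_adj_apply_of_card_ne (Ne.symm hne) (by rw [Finset.card_empty]; exact h)
  have F_01_s : ∀ T' : Finset (Fin (k + 3)), T'.card = 1 → (1 - A) {0, 1} T' = 0 := fun T' h =>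
    one_sub_adj_apply_of_card_ne (ne_of_apply_ne Finset.card (by rw [c01, h]; decide))
      (by rw [h, c01]; decide)
  have F_02_s : ∀ T' : Finset (Fin (k + 3)), T'.card = 1 → (1 - A) {0, 2} T' = 0 := fun T' h =>
    one_sub_adj_apply_of_card_ne (ne_of_apply_ne Finset.card (by rw [c02, h]; decide))
      (by rw [h, c02]; decide)
  have F_12_s : ∀ T' : Finset (Fin (k + 3)), T'.card = 1 → (1 - A) {1, 2} T' = 0 := fun T' h =>
    one_sub_adj_apply_of_card_ne (ne_of_apply_ne Finset.card (by rw [c12, h]; decide))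
      (by rw [h, c12]; decide)
  have F_01_12 : (1 - A) {0, 1} {1, 2} = 0 := one_sub_adj_apply_of_card_ne n_01_12 (by rw [c12, c01]; decide)
  have F_01_02 : (1 - A) {0, 1} {0, 2} = 0 := one_sub_adj_apply_of_card_ne n_01_02 (by rw [c02, c01]; decide)
  have F_12_02 : (1 - A) {1, 2} {0, 2} = 0 := one_sub_adj_apply_of_card_ne (Ne.symm n_02_12) (by rw [c02, c12]; decide)
  have F_02_12 : (1 - A) {0, 2} {1, 2} = 0 := one_sub_adj_apply_of_card_ne n_02_12 (by rw [c12, c02]; decide)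
  have F_0_12 : (1 - A) {0} {1, 2} = 0 := by
    rw [one_sub_adj_apply_of_ne n_0_12, neg_eq_zero]
    exact Grenet.adj_apply_of_mem_of_notMem ℂ (Finset.mem_singleton_self 0) (by simp [h01, h02])
  have F_1_02 : (1 - A) {1} {0, 2} = 0 := by
    rw [one_sub_adj_apply_of_ne n_1_02, neg_eq_zero]
    exact Grenet.adj_apply_of_mem_of_notMem ℂ (Finset.mem_singleton_self 1) (by simp [h01.symm, h12])
  have F_0_02 : (1 - A) {0} {0, 2} = -X (2, 1) := by
    rw [one_sub_adj_apply_of_ne (ne_of_apply_ne Finset.card (by rw [Finset.card_singleton, c02]; decide)),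
      show ({0, 2} : Finset (Fin (k + 3))) = insert 2 {0} from Finset.pair_comm 0 2,
      Grenet.adj_apply_insert_of_val_eq ℂ (by simp [h02.symm]) 1 (by rw [Finset.card_singleton, Fin.val_one])]
  have F_1_12 : (1 - A) {1} {1, 2} = -A {1} {1, 2} := one_sub_adj_apply_of_ne n_1_12
  have F_s_s' : ∀ a b : Fin (k + 3), a ≠ b → (1 - A) {a} {b} = 0 := fun a b h =>
    one_sub_adj_apply_of_card_ne (fun h' => h (Finset.singleton_inj.1 h'))
      (by rw [Finset.card_singleton, Finset.card_singleton]; decide)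
  rcases hS with rfl | rfl | rfl
  · /- ROW `∅`: the row of `P · (1 − adj)` is `−(1 − adj) ∅ + (1 − adj) {0,1}` -/
    have hPF : ∀ T', (P * (1 - A)) ∅ T' = -(1 - A) ∅ T' + (1 - A) {0, 1} T' := fun T' => by
      rw [hP, if_pos rfl]
    by_cases hT12 : T = {1, 2}
    · -- column `{1,2}`: `−X(0,0)` (the Koszul cancellation)
      subst hT12
      refine special_leaf_neg_X 0 ?_ ⟨fun _ => rfl, fun _ => Or.inr (Or.inr ⟨rfl, rfl⟩)⟩
      rw [hE12, hPF, hPF, hPF, F_e_g _ n12e (by rw [c12]; decide), F_01_12, F_e_j, F_e_j,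
        F_01_s _ (Finset.card_singleton 0), F_01_s _ (Finset.card_singleton 1)]
      ring
    by_cases hT1 : T = {1}
    · -- column `{1}`: `−X(1,0)`
      subst hT1
      refine special_leaf_neg_X 1 ?_ ⟨?_, fun h => absurd h h01.symm⟩
      · rw [hE1, hPF, hPF, F_e_j, F_01_s _ (Finset.card_singleton 1), F_e_g _ n02e (by rw [c02]; decide), F_01_02]
        ring
      · rintro (⟨-, h⟩ | ⟨h, -⟩ | ⟨-, h⟩)
        · exact absurd (Finset.singleton_inj.1 h) h01.symm
        · exact absurd h.symm ne1
        · exact absurd h n_1_12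
    by_cases hTc : T.card = 1
    · -- the other singleton columns `{j}`: `−X(j,0)`
      obtain ⟨j, rfl⟩ := Finset.card_eq_one.mp hTc
      refine special_leaf_neg_X j ?_ ⟨?_, ?_⟩
      · rw [hEs _ _ _ hT12 hT1 hTc, hPF, F_e_j, F_01_s _ hTc]; ring
      · rintro (⟨-, h⟩ | ⟨h, -⟩ | ⟨-, h⟩)
        · exact Finset.singleton_inj.1 h
        · exact absurd h.symm ne1
        · exact absurd h hT12
      · intro h; subst h; exact Or.inl ⟨rfl, rfl⟩
    -- generic columns: the row `{0,1}` of `1 − adj`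
    have hcond : ¬ ((∅ : Finset (Fin (k + 3))) = ∅ ∧ T = {0} ∨ (∅ : Finset (Fin (k + 3))) = {1} ∧ T = {0} ∨
        (∅ : Finset (Fin (k + 3))) = ∅ ∧ T = {1, 2}) := by
      rintro (⟨-, h⟩ | ⟨h, -⟩ | ⟨-, h⟩)
      · exact hTc (by rw [h, Finset.card_singleton])
      · exact ne1 h.symm
      · exact hT12 h
    by_cases hT01 : T = {0, 1}
    · subst hT01
      refine special_leaf_C 1 ?_ hcond
      rw [hEg _ _ _ hT12 hT1 hTc, hPF, F_e_g _ hT hTc, one_sub_adj_apply_self, neg_zero, zero_add, map_one]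
    · refine special_leaf_neg_adj T n01e ?_ hcond
      rw [hEg _ _ _ hT12 hT1 hTc, hPF, F_e_g _ hT hTc, one_sub_adj_apply_of_ne (Ne.symm hT01), neg_zero, zero_add]
  · /- ROW `{0}`: the row of `P · (1 − adj)` is `(1 − adj) {0} + (1 − adj) {1,2}` -/
    have hPF : ∀ T', (P * (1 - A)) {0} T' = (1 - A) {0} T' + (1 - A) {1, 2} T' := fun T' => by
      rw [hP, if_neg ne0, if_pos rfl]
    have hcond : ∀ T' : Finset (Fin (k + 3)), ¬ (({0} : Finset (Fin (k + 3))) = ∅ ∧ T' = {0} ∨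
        ({0} : Finset (Fin (k + 3))) = {1} ∧ T' = {0} ∨ ({0} : Finset (Fin (k + 3))) = ∅ ∧ T' = {1, 2}) := by
      rintro T' (⟨h, -⟩ | ⟨h, -⟩ | ⟨h, -⟩)
      · exact ne0 h
      · exact n_0_1 h
      · exact ne0 h
    by_cases hT12 : T = {1, 2}
    · -- column `{1,2}`: `−X(1,0)`
      subst hT12
      refine special_leaf_neg_X 1 ?_ ⟨fun h => absurd h (hcond _), fun h => absurd h h01.symm⟩
      rw [hE12, hPF, hPF, hPF, F_0_12, one_sub_adj_apply_self, one_sub_adj_apply_self,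
        F_12_s _ (Finset.card_singleton 0), F_12_s _ (Finset.card_singleton 1), F_s_s' 0 1 h01]
      ring
    by_cases hT1 : T = {1}
    · -- column `{1}`: `−adj {0} {0,2} = −X(2,1)`
      subst hT1
      refine special_leaf_neg_adj {0, 2} ne0 ?_ (hcond _)
      rw [hE1, hPF, hPF, F_s_s' 0 1 h01, F_12_s _ (Finset.card_singleton 1), F_12_02,
        one_sub_adj_apply_of_ne (ne_of_apply_ne Finset.card (by rw [Finset.card_singleton, c02]; decide))]
      ring
    by_cases hTc : T.card = 1
    · -- the other singleton columns: `−[T = {0}]`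
      obtain ⟨j, rfl⟩ := Finset.card_eq_one.mp hTc
      by_cases hj : j = 0
      · subst hj
        refine special_leaf_C (-1) ?_ (hcond _)
        rw [hEs _ _ _ hT12 hT1 hTc, hPF, one_sub_adj_apply_self, F_12_s _ hTc, add_zero, map_neg, map_one]
      · refine special_leaf_C 0 ?_ (hcond _)
        rw [hEs _ _ _ hT12 hT1 hTc, hPF, F_s_s' 0 j (Ne.symm hj), F_12_s _ hTc, add_zero, neg_zero, map_zero]
    -- generic columns
    have hT0 : ({0} : Finset (Fin (k + 3))) ≠ T := fun h => hTc (by rw [← h, Finset.card_singleton])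
    by_cases hT2 : T.card = 2
    · refine special_leaf_neg_adj T ne0 ?_ (hcond _)
      rw [hEg _ _ _ hT12 hT1 hTc, hPF, one_sub_adj_apply_of_ne hT0,
        one_sub_adj_apply_of_card_ne (Ne.symm hT12) (by rw [hT2, c12]; decide), add_zero]
    · refine special_leaf_neg_adj T n12e ?_ (hcond _)
      rw [hEg _ _ _ hT12 hT1 hTc, hPF,
        one_sub_adj_apply_of_card_ne hT0 (by rw [Finset.card_singleton]; exact hT2),
        one_sub_adj_apply_of_ne (Ne.symm hT12), zero_add]
  · /- ROW `{1}`: the row of `P · (1 − adj)` is `−(1 − adj) ∅ + (1 − adj) {1} + (1 − adj) {0,2}` -/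
    have hPF : ∀ T', (P * (1 - A)) {1} T' = -(1 - A) ∅ T' + (1 - A) {1} T' + (1 - A) {0, 2} T' :=
      fun T' => by rw [hP, if_neg ne1, if_neg (Ne.symm n_0_1), if_pos rfl]
    by_cases hT12 : T = {1, 2}
    · -- column `{1,2}`: `−adj {1} {1,2} = −X(2,1)` (another cancellation)
      subst hT12
      refine special_leaf_neg_adj {1, 2} ne1 ?_ ?_
      · rw [hE12, hPF, hPF, hPF, F_e_g _ n12e (by rw [c12]; decide), F_1_12, F_02_12, F_e_j, F_e_j,
          F_s_s' 1 0 h01.symm, one_sub_adj_apply_self, F_02_s _ (Finset.card_singleton 0),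
          F_02_s _ (Finset.card_singleton 1)]
        ring
      · rintro (⟨h, -⟩ | ⟨-, h⟩ | ⟨h, -⟩)
        · exact ne1 h
        · exact n_0_12 h.symm
        · exact ne1 h
    by_cases hT1 : T = {1}
    · -- column `{1}`: `−X(1,0)`
      subst hT1
      refine special_leaf_neg_X 1 ?_ ⟨?_, fun h => absurd h h01.symm⟩
      · rw [hE1, hPF, hPF, F_e_j, one_sub_adj_apply_self, F_02_s _ (Finset.card_singleton 1),
          F_e_g _ n02e (by rw [c02]; decide), F_1_02, one_sub_adj_apply_self]
        ring
      · rintro (⟨h, -⟩ | ⟨-, h⟩ | ⟨h, -⟩)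
        · exact absurd h ne1
        · exact absurd (Finset.singleton_inj.1 h) h01.symm
        · exact absurd h ne1
    by_cases hTc : T.card = 1
    · -- the other singleton columns `{j}`: `−X(j,0)`
      obtain ⟨j, rfl⟩ := Finset.card_eq_one.mp hTc
      have hj1 : j ≠ 1 := fun h => hT1 (by rw [h])
      refine special_leaf_neg_X j ?_ ⟨?_, ?_⟩
      · rw [hEs _ _ _ hT12 hT1 hTc, hPF, F_e_j, F_s_s' 1 j (Ne.symm hj1), F_02_s _ hTc]; ring
      · rintro (⟨h, -⟩ | ⟨-, h⟩ | ⟨h, -⟩)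
        · exact absurd h ne1
        · exact Finset.singleton_inj.1 h
        · exact absurd h ne1
      · intro h; subst h; exact Or.inr (Or.inl ⟨rfl, rfl⟩)
    -- generic columns
    have hcond : ¬ (({1} : Finset (Fin (k + 3))) = ∅ ∧ T = {0} ∨ ({1} : Finset (Fin (k + 3))) = {1} ∧ T = {0} ∨
        ({1} : Finset (Fin (k + 3))) = ∅ ∧ T = {1, 2}) := by
      rintro (⟨h, -⟩ | ⟨-, h⟩ | ⟨h, -⟩)
      · exact ne1 h
      · exact hTc (by rw [h, Finset.card_singleton])
      · exact ne1 h
    have hT1' : ({1} : Finset (Fin (k + 3))) ≠ T := Ne.symm hT1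
    by_cases hT02 : T = {0, 2}
    · subst hT02
      refine special_leaf_C 1 ?_ hcond
      rw [hEg _ _ _ hT12 hT1 hTc, hPF, F_e_g _ hT hTc, F_1_02, one_sub_adj_apply_self, neg_zero, zero_add, zero_add,
        map_one]
    by_cases hT2 : T.card = 2
    · refine special_leaf_neg_adj T ne1 ?_ hcond
      rw [hEg _ _ _ hT12 hT1 hTc, hPF, F_e_g _ hT hTc, one_sub_adj_apply_of_ne hT1',
        one_sub_adj_apply_of_card_ne (Ne.symm hT02) (by rw [hT2, c02]; decide), neg_zero, zero_add, add_zero]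
    · refine special_leaf_neg_adj T n02e ?_ hcond
      rw [hEg _ _ _ hT12 hT1 hTc, hPF, F_e_g _ hT hTc,
        one_sub_adj_apply_of_card_ne hT1' (by rw [Finset.card_singleton]; exact hT2),
        one_sub_adj_apply_of_ne (Ne.symm hT02), neg_zero, zero_add, zero_add]

end

end Summit.ValiantsHypothesis.ValiantsHypothesis.Theorems.ProjectionStabilityUniqStep
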